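import Summits.CriticalPhenomena.PercolationContinuityZ3.Theorems.PercNearOneGluingNoHeavyLowerTailCertH5
import Summits.CriticalPhenomena.PercolationContinuityZ3.Theorems.PercNearOneGluingNoHeavyLowerTailOneCutFourBlobs
import Summits.CriticalPhenomena.PercolationContinuityZ3.Theorems.PercNearOneGluingNoHeavyLowerTailCertEG3
import HarnessLib

/-!
# `NoHeavyLowerTail` (stmt-CriticalPhenomena-4575) — H5 in the engine's own form: cumulative isolation for blob
# structures of type `(p, q, r, s)` with light family `{p}, {q}, {p,q}, {r}`

Support file (depth prover nh-dp-blobmono gen 3; `--supports stmt-CriticalPhenomena-4575`).  No definitions, no sorries,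
standard axioms (it only uses the kernel-checked `CertH5.weightedCIL_oneOneTwoThree`).

BLOB STRUCTURES (as in `…CILBlobsNoLightPair`, `…CILFourBlobs`): `cls : Fin n → Fin b` labels the vertices; the same-label
pairs of `insert o A` are joined almost surely.  Here the relays carry exactly four labels `p, q, r, s` (none of them the
observer's), with masses `m_p, m_q, m_r, m_s` and a level `j` such that the LIGHT relay sets are exactly
`{p}, {q}, {p,q}, {r}` (`m_p + m_q ≤ j`, `m_r ≤ j`, `j < m_s`, `j < m_p + m_r`, `j < m_q + m_r`; e.g. masses `(1,1,2,3)`,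
`j = 2` — family H5 of the gen-1 taxonomy, or `(k,k,2k,3k)` with `2k ≤ j < 3k`).  THEN (`cumulativeIsolation_blobs_H5`)
`∃ a ∈ A, μ{1 ≤ N ≤ j} ≤ μ{|π(a)| ≤ j}` — the cumulative isolation inequality CIL (engine `stub_cumulativeIsolation` of
the crux) for every such blob structure, every `|A|`, every graph: on the good set `N = Σ_{blobs met} m_i` and
`|π(x)| = Σ_{blobs in C(x)} m_i`, so the events are the five-terminal events of `CertH5` read on representatives.
-/

noncomputable section

namespace Summit.CriticalPhenomena.PercolationContinuityZ3.Theorems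

open MeasureTheory Set Literature.Probability.Percolation
open Literature.Probability.LatticeModels (prodBernoulli)
open scoped Classical

namespace CertH5

variable {n : ℕ}

/-- **Fibre count on the good set.**  If the same-label pairs of `insert o A` are joined in `ω`, then for a label `i`
with a representative `y₀ ∈ A`, the relays of label `i` joined to `x` are all of them or none, according to `x ↔ y₀`.
[folklore] -/
theorem card_filter_label {b : ℕ} (A : Finset (Fin n)) (o : Fin n) (cls : Fin n → Fin b) (ω : BondConfig (Fin n))
    (hω : ∀ u ∈ insert o A, ∀ v ∈ insert o A, cls u = cls v → (openGraph ω).Reachable u v)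
    {i : Fin b} {y₀ : Fin n} (hy₀ : y₀ ∈ A) (hcy₀ : cls y₀ = i) (x : Fin n) :
    ((A.filter fun y => ω ∈ openConn x y).filter fun y => cls y = i).card =
      if (openGraph ω).Reachable x y₀ then (A.filter fun y => cls y = i).card else 0 := by
  split_ifs with h
  · congr 1
    ext y
    simp only [Finset.mem_filter]
    constructor
    · rintro ⟨⟨hyA, _⟩, hcy⟩; exact ⟨hyA, hcy⟩
    · rintro ⟨hyA, hcy⟩
      refine ⟨⟨hyA, ?_⟩, hcy⟩
      exact h.trans (hω y₀ (Finset.mem_insert_of_mem hy₀) y (Finset.mem_insert_of_mem hyA) (hcy₀.trans hcy.symm))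
  · rw [Finset.card_eq_zero, Finset.filter_eq_empty_iff]
    intro y hy hcy
    obtain ⟨hyA, hxy⟩ := Finset.mem_filter.1 hy
    exact h ((show (openGraph ω).Reachable x y from hxy).trans
      (hω y (Finset.mem_insert_of_mem hyA) y₀ (Finset.mem_insert_of_mem hy₀) (hcy.trans hcy₀.symm)))

/-- **Relay counts on the good set of a four-label structure.**  With labels `p,q,r,s` (pairwise distinct, covering
`A`) and representatives `a,b,c,d`, the number of relays joined to `x` is
`[x↔a] m_p + [x↔b] m_q + [x↔c] m_r + [x↔d] m_s`. [folklore] -/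
theorem card_filter_eq_four {b : ℕ} (A : Finset (Fin n)) (o : Fin n) (cls : Fin n → Fin b) (ω : BondConfig (Fin n))
    (hω : ∀ u ∈ insert o A, ∀ v ∈ insert o A, cls u = cls v → (openGraph ω).Reachable u v)
    {p q r s : Fin b} (hpq : p ≠ q) (hpr : p ≠ r) (hps : p ≠ s) (hqr : q ≠ r) (hqs : q ≠ s) (hrs : r ≠ s)
    (hA : ∀ y ∈ A, cls y = p ∨ cls y = q ∨ cls y = r ∨ cls y = s)
    {a b' c d : Fin n} (ha : a ∈ A) (hca : cls a = p) (hb : b' ∈ A) (hcb : cls b' = q) (hc : c ∈ A) (hcc : cls c = r)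
    (hd : d ∈ A) (hcd : cls d = s) (x : Fin n) :
    (A.filter fun y => ω ∈ openConn x y).card =
      (if (openGraph ω).Reachable x a then (A.filter fun y => cls y = p).card else 0) +
      (if (openGraph ω).Reachable x b' then (A.filter fun y => cls y = q).card else 0) +
      (if (openGraph ω).Reachable x c then (A.filter fun y => cls y = r).card else 0) +
      (if (openGraph ω).Reachable x d then (A.filter fun y => cls y = s).card else 0) := by
  rw [Finset.card_eq_sum_card_fiberwise (s := A.filter fun y => ω ∈ openConn x y) (t := ({p, q, r, s} : Finset (Fin b)))
    (f := cls) (fun y hy => by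
      have := hA y (Finset.mem_filter.1 hy).1
      simpa using this)]
  rw [Finset.sum_insert (by simp [hpq, hpr, hps]), Finset.sum_insert (by simp [hqr, hqs]),
    Finset.sum_insert (by simp [hrs]), Finset.sum_singleton,
    card_filter_label A o cls ω hω ha hca x, card_filter_label A o cls ω hω hb hcb x,
    card_filter_label A o cls ω hω hc hcc x, card_filter_label A o cls ω hω hd hcd x]
  ring

/-- The light event in terms of the four "blob met" indicators (pure arithmetic of the masses). [folklore] -/
theorem light_iff {mp mq mr ms j : ℕ} (hmp : 1 ≤ mp) (hmq : 1 ≤ mq) (hmr : 1 ≤ mr) (hjpq : mp + mq ≤ j)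
    (hjr : mr ≤ j) (hjs : j < ms) (hjpr : j < mp + mr) (hjqr : j < mq + mr) (P Q R S : Prop) [Decidable P]
    [Decidable Q] [Decidable R] [Decidable S] :
    (1 ≤ (if P then mp else 0) + (if Q then mq else 0) + (if R then mr else 0) + (if S then ms else 0) ∧
      (if P then mp else 0) + (if Q then mq else 0) + (if R then mr else 0) + (if S then ms else 0) ≤ j) ↔
    ((P ∧ ¬Q ∧ ¬R ∧ ¬S) ∨ (Q ∧ ¬P ∧ ¬R ∧ ¬S) ∨ (P ∧ Q ∧ ¬R ∧ ¬S) ∨ (R ∧ ¬P ∧ ¬Q ∧ ¬S)) := by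
  by_cases hP : P <;> by_cases hQ : Q <;> by_cases hR : R <;> by_cases hS : S <;>
    simp only [hP, hQ, hR, hS, if_true, if_false, and_true, and_false, not_true, not_false_iff,
      or_false, or_true, iff_true, iff_false, not_and, not_le] <;> omega

/-- The light-block event of a mass-`mp` representative (`p ∪ q` light, `p ∪ r`, `p ∪ s` heavy). [folklore] -/
theorem refP_iff {mp mq mr ms j : ℕ} (hjpq : mp + mq ≤ j) (hjs : j < ms) (hjpr : j < mp + mr) (Q R S : Prop)
    [Decidable Q] [Decidable R] [Decidable S] :
    (mp + (if Q then mq else 0) + (if R then mr else 0) + (if S then ms else 0) ≤ j) ↔ (¬R ∧ ¬S) := by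
  by_cases hQ : Q <;> by_cases hR : R <;> by_cases hS : S <;>
    simp only [hQ, hR, hS, if_true, if_false, and_true, and_false, not_true, not_false_iff,
      iff_true, iff_false, not_le] <;> omega

/-- The light-block event of the mass-`mr` representative (`r` light, `r ∪ anything` heavy). [folklore] -/
theorem refR_iff {mp mq mr ms j : ℕ} (hmp : 1 ≤ mp) (hmq : 1 ≤ mq) (hjr : mr ≤ j) (hjs : j < ms)
    (hjpr : j < mp + mr) (hjqr : j < mq + mr) (P Q S : Prop) [Decidable P] [Decidable Q] [Decidable S] :
    ((if P then mp else 0) + (if Q then mq else 0) + mr + (if S then ms else 0) ≤ j) ↔ (¬P ∧ ¬Q ∧ ¬S) := by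
  by_cases hP : P <;> by_cases hQ : Q <;> by_cases hS : S <;>
    simp only [hP, hQ, hS, if_true, if_false, and_true, and_false, not_true, not_false_iff,
      iff_true, iff_false, not_le] <;> omega

/-- Masses with a null complement do not change a probability. [folklore] -/
theorem real_eq_of_inter_good (μ : Measure (BondConfig (Fin n))) [IsFiniteMeasure μ]
    {E F G : Set (BondConfig (Fin n))} (hG : μ.real Gᶜ = 0) (hEF : E ∩ G = F ∩ G) : μ.real E = μ.real F := by
  have h1 : ∀ X : Set (BondConfig (Fin n)), μ.real X = μ.real (X ∩ G) := by
    intro X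
    apply le_antisymm
    · calc μ.real X ≤ μ.real (X ∩ G ∪ Gᶜ) := measureReal_mono fun ω hω => by
            by_cases h : ω ∈ G
            · exact Or.inl ⟨hω, h⟩
            · exact Or.inr h
        _ ≤ μ.real (X ∩ G) + μ.real Gᶜ := measureReal_union_le _ _
        _ = μ.real (X ∩ G) := by rw [hG, add_zero]
    · exact measureReal_mono Set.inter_subset_left
  rw [h1 E, h1 F, hEF]

/-- **Cumulative isolation for blob structures of type H5** (`{p}, {q}, {p,q}, {r}` light): for every weighted graph,
every relay set `A` labelled by `cls` with the same-label pairs of `insert o A` joined a.s., four relay labels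
`p, q, r, s` (pairwise distinct, none equal to the observer's label, covering `A`) with representatives `a, b, c, d` and
masses `m_p + m_q ≤ j`, `m_r ≤ j`, `j < m_s`, `j < m_p + m_r`, `j < m_q + m_r`:
`∃ x ∈ A, μ{1 ≤ N ≤ j} ≤ μ{|π(x)| ≤ j}` (`N = |{y ∈ A : o ↔ y}|`, `π(x) = {y ∈ A : x ↔ y}`).
[cite: KozmaNitzan2024, Lemma 1 (p. 5) — via the kernel-checked certificate `CertH5.weightedCIL_oneOneTwoThree`] -/
theorem cumulativeIsolation_blobs_H5 {b : ℕ} (w : Sym2 (Fin n) → unitInterval) (A : Finset (Fin n)) (o : Fin n)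
    (j : ℕ) (cls : Fin n → Fin b)
    (hcls : ∀ u ∈ insert o A, ∀ v ∈ insert o A, cls u = cls v → (prodBernoulli w).real (openConn u v)ᶜ = 0)
    {p q r s : Fin b} (hpq : p ≠ q) (hpr : p ≠ r) (hps : p ≠ s) (hqr : q ≠ r) (hqs : q ≠ s) (hrs : r ≠ s)
    (hop : cls o ≠ p) (hoq : cls o ≠ q) (hor : cls o ≠ r) (hos : cls o ≠ s)
    (hA : ∀ y ∈ A, cls y = p ∨ cls y = q ∨ cls y = r ∨ cls y = s)
    {a b' c d : Fin n} (ha : a ∈ A) (hca : cls a = p) (hb : b' ∈ A) (hcb : cls b' = q) (hc : c ∈ A) (hcc : cls c = r)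
    (hd : d ∈ A) (hcd : cls d = s)
    (hjpq : (A.filter fun y => cls y = p).card + (A.filter fun y => cls y = q).card ≤ j)
    (hjr : (A.filter fun y => cls y = r).card ≤ j) (hjs : j < (A.filter fun y => cls y = s).card)
    (hjpr : j < (A.filter fun y => cls y = p).card + (A.filter fun y => cls y = r).card)
    (hjqr : j < (A.filter fun y => cls y = q).card + (A.filter fun y => cls y = r).card) :
    ∃ x ∈ A, (prodBernoulli w).real {ω : BondConfig (Fin n) |
        1 ≤ (A.filter fun y => ω ∈ openConn o y).card ∧ (A.filter fun y => ω ∈ openConn o y).card ≤ j} ≤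
      (prodBernoulli w).real {ω : BondConfig (Fin n) | (A.filter fun y => ω ∈ openConn x y).card ≤ j} := by
  set μ := prodBernoulli w with hμ
  set G : Set (BondConfig (Fin n)) := {ω | ∀ u ∈ insert o A, ∀ v ∈ insert o A, cls u = cls v →
    (openGraph ω).Reachable u v} with hGdef
  have hG : μ.real Gᶜ = 0 := blobs_goodSet_compl_null w A o cls hcls
  -- nonempty masses
  have hmp : 1 ≤ (A.filter fun y => cls y = p).card := Finset.card_pos.2 ⟨a, Finset.mem_filter.2 ⟨ha, hca⟩⟩
  have hmq : 1 ≤ (A.filter fun y => cls y = q).card := Finset.card_pos.2 ⟨b', Finset.mem_filter.2 ⟨hb, hcb⟩⟩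
  have hmr : 1 ≤ (A.filter fun y => cls y = r).card := Finset.card_pos.2 ⟨c, Finset.mem_filter.2 ⟨hc, hcc⟩⟩
  -- distinct representatives
  have hv : Function.Injective ![o, a, b', c, d] := by
    have hoa : o ≠ a := fun h => hop (by rw [h, hca])
    have hob : o ≠ b' := fun h => hoq (by rw [h, hcb])
    have hoc : o ≠ c := fun h => hor (by rw [h, hcc])
    have hod : o ≠ d := fun h => hos (by rw [h, hcd])
    have hab : a ≠ b' := fun h => hpq (by rw [← hca, ← hcb, h])
    have hac : a ≠ c := fun h => hpr (by rw [← hca, ← hcc, h])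
    have had : a ≠ d := fun h => hps (by rw [← hca, ← hcd, h])
    have hbc : b' ≠ c := fun h => hqr (by rw [← hcb, ← hcc, h])
    have hbd : b' ≠ d := fun h => hqs (by rw [← hcb, ← hcd, h])
    have hcd' : c ≠ d := fun h => hrs (by rw [← hcc, ← hcd, h])
    exact CertEG3.injective_vec5 hoa hob hoc hod hab hac had hbc hbd hcd'
  have key := weightedCIL_oneOneTwoThree w ![o, a, b', c, d] hv
  -- the counts on the good set
  have hN : ∀ ω ∈ G, ∀ x : Fin n, (A.filter fun y => ω ∈ openConn x y).card =
      (if (openGraph ω).Reachable x a then (A.filter fun y => cls y = p).card else 0) +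
      (if (openGraph ω).Reachable x b' then (A.filter fun y => cls y = q).card else 0) +
      (if (openGraph ω).Reachable x c then (A.filter fun y => cls y = r).card else 0) +
      (if (openGraph ω).Reachable x d then (A.filter fun y => cls y = s).card else 0) :=
    fun ω hω x => card_filter_eq_four A o cls ω hω hpq hpr hps hqr hqs hrs hA ha hca hb hcb hc hcc hd hcd x
  -- abbreviations for the masses
  set mp := (A.filter fun y => cls y = p).card with hmpdef
  set mq := (A.filter fun y => cls y = q).card with hmqdef
  set mr := (A.filter fun y => cls y = r).card with hmrdef
  set ms := (A.filter fun y => cls y = s).card with hmsdef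
  -- the light event is the H5 target event, on the good set
  have hL : μ.real {ω : BondConfig (Fin n) |
        1 ≤ (A.filter fun y => ω ∈ openConn o y).card ∧ (A.filter fun y => ω ∈ openConn o y).card ≤ j} =
      μ.real {ω | (ω ∈ openConn o a ∧ ω ∉ openConn o b' ∧ ω ∉ openConn o c ∧ ω ∉ openConn o d) ∨
        (ω ∈ openConn o b' ∧ ω ∉ openConn o a ∧ ω ∉ openConn o c ∧ ω ∉ openConn o d) ∨
        (ω ∈ openConn o a ∧ ω ∈ openConn o b' ∧ ω ∉ openConn o c ∧ ω ∉ openConn o d) ∨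
        (ω ∈ openConn o c ∧ ω ∉ openConn o a ∧ ω ∉ openConn o b' ∧ ω ∉ openConn o d)} := by
    refine real_eq_of_inter_good μ hG (Set.ext fun ω => ?_)
    simp only [Set.mem_inter_iff, Set.mem_setOf_eq]
    refine and_congr_left fun hω => ?_
    rw [hN ω hω o]
    exact light_iff hmp hmq hmr hjpq hjr hjs hjpr hjqr _ _ _ _
  -- the reference events, on the good set
  have hRa : μ.real {ω : BondConfig (Fin n) | (A.filter fun y => ω ∈ openConn a y).card ≤ j} =
      μ.real {ω | ω ∉ openConn a c ∧ ω ∉ openConn a d} := by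
    refine real_eq_of_inter_good μ hG (Set.ext fun ω => ?_)
    simp only [Set.mem_inter_iff, Set.mem_setOf_eq]
    refine and_congr_left fun hω => ?_
    rw [hN ω hω a, if_pos (SimpleGraph.Reachable.refl a)]
    exact refP_iff hjpq hjs hjpr _ _ _
  have hRb : μ.real {ω : BondConfig (Fin n) | (A.filter fun y => ω ∈ openConn b' y).card ≤ j} =
      μ.real {ω | ω ∉ openConn b' c ∧ ω ∉ openConn b' d} := by
    refine real_eq_of_inter_good μ hG (Set.ext fun ω => ?_)
    simp only [Set.mem_inter_iff, Set.mem_setOf_eq]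
    refine and_congr_left fun hω => ?_
    rw [hN ω hω b', if_pos (SimpleGraph.Reachable.refl b')]
    rw [show (if (openGraph ω).Reachable b' a then mp else 0) + mq =
      mq + (if (openGraph ω).Reachable b' a then mp else 0) from add_comm _ _]
    exact refP_iff (by omega) hjs hjqr _ _ _
  have hRc : μ.real {ω : BondConfig (Fin n) | (A.filter fun y => ω ∈ openConn c y).card ≤ j} =
      μ.real {ω | ω ∉ openConn c a ∧ ω ∉ openConn c b' ∧ ω ∉ openConn c d} := by
    refine real_eq_of_inter_good μ hG (Set.ext fun ω => ?_)
    simp only [Set.mem_inter_iff, Set.mem_setOf_eq]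
    refine and_congr_left fun hω => ?_
    rw [hN ω hω c, if_pos (SimpleGraph.Reachable.refl c)]
    exact refR_iff hmp hmq hjr hjs hjpr hjqr _ _ _
  -- conclude with the certificate
  rw [hL]
  rcases le_total ((prodBernoulli w).real {ω | ω ∉ openConn b' c ∧ ω ∉ openConn b' d})
      ((prodBernoulli w).real {ω | ω ∉ openConn a c ∧ ω ∉ openConn a d}) with h1 | h1
  · rcases le_total ((prodBernoulli w).real {ω | ω ∉ openConn c a ∧ ω ∉ openConn c b' ∧ ω ∉ openConn c d})
        ((prodBernoulli w).real {ω | ω ∉ openConn a c ∧ ω ∉ openConn a d}) with h2 | h2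
    · refine ⟨a, ha, ?_⟩
      rw [hRa]
      refine key.trans (max_le le_rfl (max_le h1 h2))
    · refine ⟨c, hc, ?_⟩
      rw [hRc]
      refine key.trans (max_le h2 (max_le (h1.trans h2) le_rfl))
  · rcases le_total ((prodBernoulli w).real {ω | ω ∉ openConn c a ∧ ω ∉ openConn c b' ∧ ω ∉ openConn c d})
        ((prodBernoulli w).real {ω | ω ∉ openConn b' c ∧ ω ∉ openConn b' d}) with h2 | h2
    · refine ⟨b', hb, ?_⟩
      rw [hRb]
      refine key.trans (max_le h1 (max_le le_rfl h2))
    · refine ⟨c, hc, ?_⟩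
      rw [hRc]
      refine key.trans (max_le (h1.trans h2) (max_le h2 le_rfl))

end CertH5

end Summit.CriticalPhenomena.PercolationContinuityZ3.Theorems

end
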